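import Mathlib
import Literature.MathematicalPhysics.QuantumFieldTheory.OSReconstructionNoE1Proofs
import HarnessLib

/-!
# One-gap stretching of a level-separated pair: the Gram kernel as a re-centred OS pairing

Crux `MirrorModularBoosts.PlanarSpectralCone` (stmt-QuantumFields-9664), line
`positivity-disc-to-operator-cone`, stub `stub_oneGap` (density half), PART A: kinematics.

Let `S` be a one-species Schwinger family on `ℝ⁴` with E2 along `e₀` and translation invariance
on `⁰𝒮` (`h : OSReconstructionNoE1 S.toLabelled`), `P` a time-ordered `k`-point test function
supported at times `< T` and `Q` a time-ordered `l`-point test function supported at times `> T`.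
For `s ≥ 0` the appended tensor `P ⊗ Q_{s e₀}` is time-ordered, with field vector
`Ψ(s) = Ψ_{P ⊗ Q_{s e₀}}`. This file proves:

* time-ordering of `P ⊗ Q_{se₀}`, of `Q' = Q_{−Te₀}` and of `R(σ) = (ΘP* ⊗ P ⊗ Q_{σe₀})_{+Te₀}`;
* the **re-centred pairing identity** (the mirror moved from time `0` to time level `T`, using
  translation invariance on `⁰𝒮` by `(T+s)e₀` and an arity cast `(k+l)+(k+l) = l+(k+(k+l))`):
  `⟪Ψ(s), Ψ(s')⟫ = ⟪Ψ_{Q'}, e^{-sH} Ψ_{R(s')}⟫` for `s, s' ≥ 0`;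
* the two-parameter test function `Θ(P ⊗ Q_{s})* ⊗ (P ⊗ Q_{s'})` is one fixed test function
  translated by an explicit vector of sup-norm `≤ |s| + |s'|`, whence joint continuity in `(s,s')`
  and polynomial growth of the Schwinger function value (temperedness, OS (4.8)).

These are the inputs that make `(s,s') ↦ ⟪Ψ(s), Ψ(s')⟫` two-slot sector data of opening `π/2`
(Part B/C). References: Osterwalder–Schrader, CMP 31 (1973) §4.1 (4.5)–(4.8); CMP 42 (1975) Ch. V.
No definitions; `E4 = EuclideanSpace ℝ (Fin 4)` is spelled out.
-/

noncomputable section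

namespace Summit.QuantumFields.YangMills.Cruxes.PlanarSpectralCone.PositivityDiscToOperatorCone

open MeasureTheory Complex Set Filter
open scoped InnerProductSpace SchwartzMap ComplexConjugate
open Literature.MathematicalPhysics.QuantumLattice Literature.MathematicalPhysics.AQFT
  Literature.MathematicalPhysics.QuantumFieldTheory

namespace OneGap

/-! ### Arity casts -/

/-- A Schwinger family does not see an arity cast `Fin N = Fin N'`. -/
theorem apply_cast_arity (S : SchwingerFamily (EuclideanSpace ℝ (Fin 4))) {N N' : ℕ} (hN : N = N')
    (G : 𝓢((Fin N → EuclideanSpace ℝ (Fin 4)), ℂ)) :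
    S N' (cast (congrArg (fun M => 𝓢((Fin M → EuclideanSpace ℝ (Fin 4)), ℂ)) hN) G) = S N G := by
  subst hN; rfl

/-- Pointwise value of an arity cast: `(cast G) x = G (x ∘ Fin.cast)`. -/
theorem cast_arity_apply {N N' : ℕ} (hN : N = N') (G : 𝓢((Fin N → EuclideanSpace ℝ (Fin 4)), ℂ))
    (x : Fin N' → EuclideanSpace ℝ (Fin 4)) :
    (cast (congrArg (fun M => 𝓢((Fin M → EuclideanSpace ℝ (Fin 4)), ℂ)) hN) G) x =
      G (fun i => x (Fin.cast hN i)) := by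
  subst hN; rfl

/-! ### Time vectors -/

/-- `timeVec (-T) = -timeVec T`. -/
theorem timeVec_neg (T : ℝ) :
    (SchwingerFamily.timeVec (d := 4) (-T) : EuclideanSpace ℝ (Fin 4)) = -SchwingerFamily.timeVec T := by
  ext i; by_cases hi : i = 0 <;> simp [SchwingerFamily.timeVec, hi]

/-! ### Time ordering of the stretched pair, of `Q'` and of `R(σ)` -/

/-- **`P ⊗ Q_{se₀}` is time-ordered** (`s ≥ 0`) when `P` is time-ordered below level `T` and `Q` is
time-ordered above it. -/
theorem isTimeOrdered_stretch {k l : ℕ} {P : 𝓢((Fin k → EuclideanSpace ℝ (Fin 4)), ℂ)}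
    {Q : 𝓢((Fin l → EuclideanSpace ℝ (Fin 4)), ℂ)} {T : ℝ}
    (hP : IsTimeOrdered P) (hQ : IsTimeOrdered Q)
    (hPT : tsupport (P : (Fin k → EuclideanSpace ℝ (Fin 4)) → ℂ) ⊆ {x | ∀ i, x i 0 < T})
    (hQT : tsupport (Q : (Fin l → EuclideanSpace ℝ (Fin 4)) → ℂ) ⊆ {x | ∀ i, T < x i 0})
    {s : ℝ} (hs : 0 ≤ s) :
    IsTimeOrdered (P.appendTensor (translateMulti (SchwingerFamily.timeVec s) Q)) := by
  intro x hx
  obtain ⟨hA, hB⟩ := OSReconstructionNoE1.tsupport_appendTensor_subset _ _ hx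
  have hB' := OSReconstructionNoE1.tsupport_translateMulti_subset _ _ hB
  obtain ⟨hP1, hP2⟩ := hP hA
  obtain ⟨hQ1, hQ2⟩ := hQ hB'
  have hPT' := hPT hA
  have hQT' := hQT hB'
  simp only [Set.mem_setOf_eq, PiLp.sub_apply, OSReconstructionNoE1.timeVec_apply_zero] at hP1 hP2 hQ1 hQ2 hPT' hQT'
  refine ⟨fun i => ?_, fun i j hij => ?_⟩
  · induction i using Fin.addCases with
    | left i => exact hP1 i
    | right j => have := hQ1 j; linarith
  · induction i using Fin.addCases with
    | left i =>
      induction j using Fin.addCases with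
      | left j =>
        have hij' : (i : ℕ) < (j : ℕ) := by have := Fin.lt_def.1 hij; simpa using this
        exact hP2 (Fin.lt_def.2 hij')
      | right j =>
        have h1 := hPT' i
        have h2 := hQT' j
        show x (Fin.castAdd l i) 0 < x (Fin.natAdd k j) 0
        linarith
    | right i =>
      induction j using Fin.addCases with
      | left j =>
        exfalso
        have : (k + (i : ℕ)) < (j : ℕ) := by have := Fin.lt_def.1 hij; simpa using this
        omega
      | right j =>
        have hij' : (i : ℕ) < (j : ℕ) := by have := Fin.lt_def.1 hij; simpa using this
        have := hQ2 (Fin.lt_def.2 hij')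
        show x (Fin.natAdd k i) 0 < x (Fin.natAdd k j) 0
        linarith

/-- **`Q' = Q_{−Te₀}` is time-ordered** (its times are those of `Q` lowered by `T`, still positive). -/
theorem isTimeOrdered_lower {l : ℕ} {Q : 𝓢((Fin l → EuclideanSpace ℝ (Fin 4)), ℂ)} {T : ℝ}
    (hQ : IsTimeOrdered Q)
    (hQT : tsupport (Q : (Fin l → EuclideanSpace ℝ (Fin 4)) → ℂ) ⊆ {x | ∀ i, T < x i 0}) :
    IsTimeOrdered (translateMulti (SchwingerFamily.timeVec (-T)) Q) := by
  intro x hx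
  have hB' := OSReconstructionNoE1.tsupport_translateMulti_subset _ _ hx
  obtain ⟨-, hQ2⟩ := hQ hB'
  have hQT' := hQT hB'
  simp only [Set.mem_setOf_eq, PiLp.sub_apply, OSReconstructionNoE1.timeVec_apply_zero] at hQ2 hQT'
  refine ⟨fun i => ?_, fun i j hij => ?_⟩
  · have := hQT' i; linarith
  · have := hQ2 hij; simp only at this; linarith

/-- **`R(σ) = (ΘP* ⊗ (P ⊗ Q_{σe₀}))_{+Te₀}` is time-ordered** for `σ ≥ 0`: the reflected `P`-block
has times `T − xᵢ⁰ ∈ (0,T)` in increasing order, the `P`-block times `T + xᵢ⁰`, the `Q`-block times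
`T + σ + yⱼ⁰ > 2T` (here `T ≥ 0`). -/
theorem isTimeOrdered_recentre {k l : ℕ} {P : 𝓢((Fin k → EuclideanSpace ℝ (Fin 4)), ℂ)}
    {Q : 𝓢((Fin l → EuclideanSpace ℝ (Fin 4)), ℂ)} {T : ℝ}
    (hP : IsTimeOrdered P) (hQ : IsTimeOrdered Q)
    (hPT : tsupport (P : (Fin k → EuclideanSpace ℝ (Fin 4)) → ℂ) ⊆ {x | ∀ i, x i 0 < T})
    (hQT : tsupport (Q : (Fin l → EuclideanSpace ℝ (Fin 4)) → ℂ) ⊆ {x | ∀ i, T < x i 0})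
    (hT : 0 ≤ T) {σ : ℝ} (hσ : 0 ≤ σ) :
    IsTimeOrdered (translateMulti (SchwingerFamily.timeVec T)
      ((osAdjoint P).appendTensor (P.appendTensor (translateMulti (SchwingerFamily.timeVec σ) Q)))) := by
  intro x hx
  have hx' := OSReconstructionNoE1.tsupport_translateMulti_subset _ _ hx
  obtain ⟨hA, hB⟩ := OSReconstructionNoE1.tsupport_appendTensor_subset _ _ hx'
  have hA' := OSReconstructionNoE1.tsupport_osAdjoint_subset _ hA
  -- the reflected P block
  obtain ⟨hP1, hP2⟩ := hP hA'
  have hPT' := hPT hA'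
  -- the stretched block `P ⊗ Q_σ`
  obtain ⟨hF1, hF2⟩ := isTimeOrdered_stretch hP hQ hPT hQT hσ hB
  simp only [Set.mem_setOf_eq, PiLp.sub_apply, OSReconstructionNoE1.timeVec_apply_zero,
    OSReconstructionNoE1.timeReflection_apply_zero] at hP1 hP2 hPT' hF1 hF2
  refine ⟨fun i => ?_, fun i j hij => ?_⟩
  · induction i using Fin.addCases with
    | left i => have := hPT' (Fin.rev i); rw [Fin.rev_rev] at this; linarith
    | right j => have := hF1 j; linarith
  · induction i using Fin.addCases with
    | left i =>
      induction j using Fin.addCases with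
      | left j =>
        have hij' : (i : ℕ) < (j : ℕ) := by have := Fin.lt_def.1 hij; simpa using this
        have hr : Fin.rev j < Fin.rev i := Fin.rev_lt_rev.2 (Fin.lt_def.2 hij')
        have := hP2 hr
        simp only [Fin.rev_rev] at this
        show x (Fin.castAdd (k + l) i) 0 < x (Fin.castAdd (k + l) j) 0
        linarith
      | right j =>
        have h1 := hP1 (Fin.rev i)
        rw [Fin.rev_rev] at h1
        have h2 := hF1 j
        show x (Fin.castAdd (k + l) i) 0 < x (Fin.natAdd k j) 0
        linarith
    | right i =>
      induction j using Fin.addCases with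
      | left j =>
        exfalso
        have : (k + (i : ℕ)) < (j : ℕ) := by have := Fin.lt_def.1 hij; simpa using this
        omega
      | right j =>
        have hij' : (i : ℕ) < (j : ℕ) := by have := Fin.lt_def.1 hij; simpa using this
        have := hF2 (Fin.lt_def.2 hij')
        show x (Fin.natAdd k i) 0 < x (Fin.natAdd k j) 0
        linarith

/-! ### The re-centred pairing identity -/

/-- Index bookkeeping for the re-centring: the four blocks of
`Θ(P ⊗ Q_s)* ⊗ (P ⊗ Q_{s'})` translated by `(T+s)e₀` and read through the arity cast
`(k+l)+(k+l) = l+(k+(k+l))` are the blocks of `ΘQ'* ⊗ (R(s'))_{se₀}`. -/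
theorem isAppendTensorOf_recentre {k l : ℕ} (P : 𝓢((Fin k → EuclideanSpace ℝ (Fin 4)), ℂ))
    (Q : 𝓢((Fin l → EuclideanSpace ℝ (Fin 4)), ℂ)) (T s s' : ℝ)
    (hN : (k + l) + (k + l) = l + (k + (k + l))) :
    IsAppendTensorOf
      (cast (congrArg (fun M => 𝓢((Fin M → EuclideanSpace ℝ (Fin 4)), ℂ)) hN)
        (translateMulti (SchwingerFamily.timeVec (T + s))
          ((osAdjoint (P.appendTensor (translateMulti (SchwingerFamily.timeVec s) Q))).appendTensor
            (P.appendTensor (translateMulti (SchwingerFamily.timeVec s') Q)))))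
      (osAdjoint (translateMulti (SchwingerFamily.timeVec (-T)) Q))
      (translateMulti (SchwingerFamily.timeVec s)
        (translateMulti (SchwingerFamily.timeVec T)
          ((osAdjoint P).appendTensor (P.appendTensor (translateMulti (SchwingerFamily.timeVec s') Q))))) := by
  intro x
  rw [cast_arity_apply hN]
  simp only [SchwartzMap.appendTensor_apply, translateMulti_apply, osAdjoint_apply, Function.comp_def]
  -- the four index identities (values in `Fin (l + (k + (k + l)))`)
  have I1 : ∀ i : Fin k, Fin.cast hN (Fin.castAdd (k + l) (Fin.castAdd l i).rev) =
      Fin.natAdd l (Fin.castAdd (k + l) i.rev) := fun i => by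
    apply Fin.ext; simp only [Fin.val_cast, Fin.val_castAdd, Fin.val_rev, Fin.val_natAdd]; omega
  have I2 : ∀ i : Fin l, Fin.cast hN (Fin.castAdd (k + l) (Fin.natAdd k i).rev) =
      Fin.castAdd (k + (k + l)) i.rev := fun i => by
    apply Fin.ext; simp only [Fin.val_cast, Fin.val_castAdd, Fin.val_rev, Fin.val_natAdd]; omega
  have I3 : ∀ i : Fin k, Fin.cast hN (Fin.natAdd (k + l) (Fin.castAdd l i)) =
      Fin.natAdd l (Fin.natAdd k (Fin.castAdd l i)) := fun i => by
    apply Fin.ext; simp only [Fin.val_cast, Fin.val_castAdd, Fin.val_natAdd]; omega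
  have I4 : ∀ i : Fin l, Fin.cast hN (Fin.natAdd (k + l) (Fin.natAdd k i)) =
      Fin.natAdd l (Fin.natAdd k (Fin.natAdd k i)) := fun i => by
    apply Fin.ext; simp only [Fin.val_cast, Fin.val_natAdd]; omega
  -- the vector identities
  have V : ∀ y : EuclideanSpace ℝ (Fin 4),
      (timeReflection 4) (y - SchwingerFamily.timeVec (T + s)) =
        (timeReflection 4) y + SchwingerFamily.timeVec T + SchwingerFamily.timeVec s := fun y => by
    rw [map_sub, SchwingerFamily.timeReflection_timeVec, SchwingerFamily.timeVec_add]; abel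
  have V' : ∀ y : EuclideanSpace ℝ (Fin 4),
      (timeReflection 4) (y - SchwingerFamily.timeVec s - SchwingerFamily.timeVec T) =
        (timeReflection 4) y + SchwingerFamily.timeVec T + SchwingerFamily.timeVec s := fun y => by
    rw [map_sub, map_sub, SchwingerFamily.timeReflection_timeVec, SchwingerFamily.timeReflection_timeVec]
    abel
  have E1 : (fun i : Fin k => (timeReflection 4)
        (x (Fin.cast hN (Fin.castAdd (k + l) (Fin.castAdd l i).rev)) - SchwingerFamily.timeVec (T + s))) =
      fun i => (timeReflection 4) (x (Fin.natAdd l (Fin.castAdd (k + l) i.rev)) -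
        SchwingerFamily.timeVec s - SchwingerFamily.timeVec T) := by
    funext i; rw [I1, V, V']
  have E2 : (fun i : Fin l => (timeReflection 4)
        (x (Fin.cast hN (Fin.castAdd (k + l) (Fin.natAdd k i).rev)) - SchwingerFamily.timeVec (T + s)) -
          SchwingerFamily.timeVec s) =
      fun i => (timeReflection 4) (x (Fin.castAdd (k + (k + l)) i.rev)) - SchwingerFamily.timeVec (-T) := by
    funext i; rw [I2, V, timeVec_neg]; abel
  have E3 : (fun i : Fin k => x (Fin.cast hN (Fin.natAdd (k + l) (Fin.castAdd l i))) -
        SchwingerFamily.timeVec (T + s)) =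
      fun i => x (Fin.natAdd l (Fin.natAdd k (Fin.castAdd l i))) - SchwingerFamily.timeVec s -
        SchwingerFamily.timeVec T := by
    funext i; rw [I3, SchwingerFamily.timeVec_add]; abel
  have E4 : (fun i : Fin l => x (Fin.cast hN (Fin.natAdd (k + l) (Fin.natAdd k i))) -
        SchwingerFamily.timeVec (T + s) - SchwingerFamily.timeVec s') =
      fun i => x (Fin.natAdd l (Fin.natAdd k (Fin.natAdd k i))) - SchwingerFamily.timeVec s -
        SchwingerFamily.timeVec T - SchwingerFamily.timeVec s' := by
    funext i; rw [I4, SchwingerFamily.timeVec_add]; abel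
  rw [E1, E2, E3, E4, map_mul]
  ring

/-- **The re-centred pairing identity.** For `s ≥ 0`,
`⟪Ψ_{P⊗Q_{se₀}}, Ψ_{P⊗Q_{s'e₀}}⟫ = ⟪Ψ_{Q_{−Te₀}}, e^{-sH} Ψ_{R(s')}⟫` with
`R(s') = (ΘP* ⊗ (P ⊗ Q_{s'e₀}))_{+Te₀}`, whenever the four test functions involved are time-ordered
(for `P` below level `T ≥ 0`, `Q` above it and `s' ≥ 0` they are: `isTimeOrdered_stretch`,
`isTimeOrdered_lower`, `isTimeOrdered_recentre`): both sides are the value of `𝔖_{2k+2l}` on the same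
configuration up to the translation by `(T+s)e₀` of every point (translation invariance on `⁰𝒮`;
OS 1973 (4.5)–(4.7) with the mirror re-centred at level `T`). -/
theorem inner_stretch_eq (S : SchwingerFamily (EuclideanSpace ℝ (Fin 4)))
    (h : OSReconstructionNoE1 S.toLabelled) {k l : ℕ}
    (P : 𝓢((Fin k → EuclideanSpace ℝ (Fin 4)), ℂ)) (Q : 𝓢((Fin l → EuclideanSpace ℝ (Fin 4)), ℂ))
    (T : ℝ) {s s' : ℝ} (hs : 0 ≤ s)
    (h1 : IsTimeOrdered (P.appendTensor (translateMulti (SchwingerFamily.timeVec s) Q)))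
    (h2 : IsTimeOrdered (P.appendTensor (translateMulti (SchwingerFamily.timeVec s') Q)))
    (h3 : IsTimeOrdered (translateMulti (SchwingerFamily.timeVec (-T)) Q))
    (h4 : IsTimeOrdered (translateMulti (SchwingerFamily.timeVec T)
      ((osAdjoint P).appendTensor (P.appendTensor (translateMulti (SchwingerFamily.timeVec s') Q))))) :
    ⟪h.fieldVec (k + l) (fun _ => ()) (P.appendTensor (translateMulti (SchwingerFamily.timeVec s) Q)) h1,
      h.fieldVec (k + l) (fun _ => ()) (P.appendTensor (translateMulti (SchwingerFamily.timeVec s') Q)) h2⟫_ℂ =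
    ⟪h.fieldVec l (fun _ => ()) (translateMulti (SchwingerFamily.timeVec (-T)) Q) h3,
      h.transfer s (h.fieldVec (k + (k + l)) (fun _ => ())
        (translateMulti (SchwingerFamily.timeVec T)
          ((osAdjoint P).appendTensor (P.appendTensor (translateMulti (SchwingerFamily.timeVec s') Q)))) h4)⟫_ℂ := by
  have hN : (k + l) + (k + l) = l + (k + (k + l)) := by ring
  rw [h.inner_fieldVec_fieldVec _ _ _ _ (isAppendTensorOf_appendTensor _ _),
    OSReconstructionNoE1.transfer_fieldVec _ hs,
    h.inner_fieldVec_fieldVec _ _ _ _ (isAppendTensorOf_recentre P Q T s s' hN)]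
  simp only [SchwingerFamily.toLabelled_apply]
  rw [apply_cast_arity S hN]
  exact (h.translationInvariant ((k + l) + (k + l)) (fun _ => ()) (SchwingerFamily.timeVec (T + s)) _
    (OSReconstructionNoE1.isOffDiagonal_appendTensor_osAdjoint h1 h2)).symm

end OneGap

end Summit.QuantumFields.YangMills.Cruxes.PlanarSpectralCone.PositivityDiscToOperatorCone
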